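import Literature.AlgebraicGeometry.Resolution.KrullRamificationGroups
import Mathlib.LinearAlgebra.LinearIndependent.Basic
import Mathlib.FieldTheory.Fixed
import HarnessLib

/-!
# Valuation independence of Galois groups with trivial ramification group (Kuhlmann–Vlahu 2014, §13)

Topic: `Literature/AlgebraicGeometry/Resolution` (valued function fields). F.-V. Kuhlmann,
I. Vlahu, *The relative approximation degree in valued function fields*, Math. Z. 276 (2014)
203–235 = arXiv:1304.0200, §13:

> Take a Galois extension `(L|K,v)` of henselian fields. Its Galois group `Gal L|K` will be
> called **valuation independent** if for every choice of elements `d₁,…,d_n ∈ L̃` and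
> automorphisms `σ₁,…,σ_n ∈ Gal L|K` there exists an element `d ∈ L` such that
> `v ∑ σᵢ(d) dᵢ = minᵢ v σᵢ(d) dᵢ`.
> **Theorem 13.2.** A Galois extension of henselian fields is tame if and only if its Galois
> group is valuation independent.
> *Proof.* … `χ_σ(d) := (σ(d)/d)v` … is a crossed homomorphism … its kernel is the
> ramification group `G^r(L|K,v)`. The theorem of Artin on linear independence of characters
> tells us that if the `χ_{σᵢ}` are distinct characters, then an element `d` satisfying (13.4)
> will exist. This shows that `G` is valuation independent if the map in (13.5) is injective.

This file PROVES the direction used by the pull-down principle (§14, Lemma 14.4): **if the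
(large) ramification group of `Gal(L|F)` is trivial, then `Gal(L|F)` is valuation
independent**, in the ambient rendering of `KrullRamificationGroups.lean` (`(Ω, V)`, `F ≤ Ω`,
`L` a finite extension of `F` inside `Ω` on which every automorphism preserves the valuation —
as is the case over a henselian `F` —, `ramificationGroupIn V L` the automorphisms `σ` with
`v(σ x − x) > v(x)` for all `x ≠ 0`). The characters are the residue characters
`χ_σ : L^× → (Ωv)^×`, `d ↦ (σ d / d)v`; `χ_σ ≠ χ_τ` for `σ ≠ τ` is exactly `τ⁻¹σ ∉ G^r`; Artin's
theorem is Mathlib's `linearIndependent_monoidHom` (Dedekind's independence of characters).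
(That trivial ramification group characterizes TAME Galois extensions of henselian fields —
the other half of Thm. 13.2 and [ZS] VI §12 Thm. 24 — is not needed here and not proved.)

## Content (PROVED; no definitions, no named facts)

* `exists_valuation_apply_sub_apply_eq` — for `σ ≠ τ` there is `x ≠ 0` with
  `v(σ x − τ x) = v(x)` (distinctness of the residue characters).
* `exists_valuation_sum_mul_apply_eq` — **valuation independence, normalized form**: for
  coefficients `c_σ ∈ Ω` with `|c_σ| ≤ |c_{σ₀}| ≠ 0` there is `d ∈ L^×` with
  `|∑_σ c_σ σ(d)| = |c_{σ₀}| |d|` [cite: KuhlmannVlahu2014, Thm. 13.2 (proof)].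
* `exists_valuation_mul_apply_le_sum` — **valuation independence** as printed ((13.1)): for
  coefficients `c_σ ∈ Ω`, not all zero, there is `d ∈ L^×` with
  `|c_σ σ(d)| ≤ |∑_τ c_τ τ(d)| ≠ 0` for all `σ` [cite: KuhlmannVlahu2014, Section 13, (13.1)].

## Sources

* F.-V. Kuhlmann, I. Vlahu, Math. Z. 276 (2014) = arXiv:1304.0200, §13: (13.1), Lemma 13.1,
  Thm. 13.2 and its proof (p. 24). [KuhlmannVlahu2014]
* Artin's (Dedekind's) independence of characters: S. Lang, *Algebra*, VI §4 Thm. 4.1, through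
  Mathlib (`linearIndependent_monoidHom`).
-/

noncomputable section

open Module IntermediateField IsLocalRing Finset

namespace Literature.AlgebraicGeometry.Resolution

universe u

variable {Ω : Type u} [Field Ω] (V : ValuationSubring Ω) {F : Subfield Ω}
  (L : IntermediateField F Ω)

/-! ### Distinct automorphisms have distinct residue characters -/

/-- **`σ ≠ τ` have distinct residue characters when the ramification group is trivial**: if
every automorphism of `L|F` preserves `v` and `G^r(L|F) = 1`, then for `σ ≠ τ` there is
`x ∈ L^×` with `v(σ x − τ x) = v(x)`, i.e. `(σ x / x)v ≠ (τ x / x)v` (apply `τ` to a witness of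
`τ⁻¹σ ∉ G^r`). [cite: KuhlmannVlahu2014, Thm. 13.2 (proof)] -/
theorem exists_valuation_apply_sub_apply_eq
    (hV : ∀ (σ : L ≃ₐ[F] L) (x : L), V.valuation ((σ x : L) : Ω) = V.valuation (x : Ω))
    (hram : ramificationGroupIn V L = ⊥) {σ τ : L ≃ₐ[F] L} (h : σ ≠ τ) :
    ∃ x : L, x ≠ 0 ∧ V.valuation (((σ x : L) : Ω) - τ x) = V.valuation (x : Ω) := by
  have hne : τ⁻¹ * σ ≠ 1 := by
    intro h1
    apply h
    have h2 : τ * (τ⁻¹ * σ) = τ * 1 := by rw [h1]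
    rwa [← mul_assoc, mul_inv_cancel, one_mul, mul_one] at h2
  have hnot : τ⁻¹ * σ ∉ ramificationGroupIn V L := by
    rw [hram, Subgroup.mem_bot]
    exact hne
  rw [mem_ramificationGroupIn_iff] at hnot
  push Not at hnot
  obtain ⟨x, hx, hle⟩ := hnot
  have hid : ((τ ((τ⁻¹ * σ) x - x) : L) : Ω) = ((σ x : L) : Ω) - τ x := by
    rw [map_sub, AlgEquiv.mul_apply, AlgEquiv.aut_inv, AlgEquiv.apply_symm_apply]
    push_cast
    rfl
  refine ⟨x, hx, le_antisymm ?_ ?_⟩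
  · -- ultrametric inequality and `v(σ x) = v(τ x) = v(x)`
    calc V.valuation (((σ x : L) : Ω) - τ x)
        ≤ max (V.valuation ((σ x : L) : Ω)) (V.valuation ((τ x : L) : Ω)) :=
          Valuation.map_sub _ _ _
      _ = V.valuation (x : Ω) := by rw [hV σ x, hV τ x, max_self]
  · rw [← hid, hV τ]
    push_cast
    exact hle

/-! ### Valuation independence -/

/-- **Kuhlmann–Vlahu 2014, Thm. 13.2 (the direction `G^r = 1 ⇒` valuation independent),
normalized form.** Let every automorphism of the finite extension `L|F` inside `(Ω, V)`
preserve `v`, and let the ramification group `G^r(L|F)` be trivial. For coefficients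
`c : Gal(L|F) → Ω` and `σ₀` with `|c σ| ≤ |c σ₀| ≠ 0` for all `σ`, there is `d ∈ L`, `d ≠ 0`,
with `|∑_σ c_σ · σ(d)| = |c_{σ₀}| · |d|` — no cancellation in the sum. PROVED as printed: the
residue characters `χ_σ : L^× → Ωv`, `d ↦ (σ d/d)v`, are pairwise distinct
(`exists_valuation_apply_sub_apply_eq`), hence linearly independent over `Ωv` (Artin), so some
`d ∈ L^×` has `∑_σ (c_σ/c_{σ₀})v · χ_σ(d) ≠ 0`. [cite: KuhlmannVlahu2014, Thm. 13.2 (proof)] -/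
theorem exists_valuation_sum_mul_apply_eq [FiniteDimensional F L]
    (hV : ∀ (σ : L ≃ₐ[F] L) (x : L), V.valuation ((σ x : L) : Ω) = V.valuation (x : Ω))
    (hram : ramificationGroupIn V L = ⊥) (c : (L ≃ₐ[F] L) → Ω) {σ₀ : L ≃ₐ[F] L}
    (hσ₀ : c σ₀ ≠ 0) (hmax : ∀ σ, V.valuation (c σ) ≤ V.valuation (c σ₀)) :
    ∃ d : L, d ≠ 0 ∧
      V.valuation (∑ σ, c σ * ((σ d : L) : Ω)) = V.valuation (c σ₀) * V.valuation (d : Ω) := by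
  classical
  have hc₀ : V.valuation (c σ₀) ≠ 0 := (Valuation.ne_zero_iff _).mpr hσ₀
  -- the normalized coefficients `e σ = c σ / c σ₀ ∈ V`
  set e : (L ≃ₐ[F] L) → Ω := fun σ => c σ / c σ₀ with he
  have heV : ∀ σ, e σ ∈ V := fun σ => by
    rw [← V.valuation_le_one_iff, he]
    dsimp only
    rw [map_div₀]
    exact div_le_one_of_le₀ (hmax σ) zero_le
  have he₀ : e σ₀ = 1 := div_self hσ₀
  -- the quotients `σ u / u` are `v`-units
  have hq : ∀ (σ : L ≃ₐ[F] L) (u : Lˣ), V.valuation (((σ (u : L) : L) : Ω) / ((u : L) : Ω)) = 1 := by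
    intro σ u
    have hu0 : ((u : L) : Ω) ≠ 0 := by exact_mod_cast u.ne_zero
    rw [map_div₀, hV, div_self ((Valuation.ne_zero_iff _).mpr hu0)]
  have hqV : ∀ (σ : L ≃ₐ[F] L) (u : Lˣ), ((σ (u : L) : L) : Ω) / ((u : L) : Ω) ∈ V := fun σ u =>
    (V.valuation_le_one_iff _).mp (hq σ u).le
  -- residues compared through `v(a - b) < 1`, and non-vanishing through `v = 1`
  have hres_ne : ∀ {w : Ω} (hw : w ∈ V), residue V ⟨w, hw⟩ ≠ 0 ↔ V.valuation w = 1 := by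
    intro w hw
    rw [ne_eq, residue_eq_zero_iff, V.valuation_lt_one_iff]
    change ¬ V.valuation w < 1 ↔ _
    rw [not_lt]
    exact ⟨fun h => le_antisymm ((V.valuation_le_one_iff _).mpr hw) h, fun h => h.ge⟩
  -- the residue characters
  let χ : (L ≃ₐ[F] L) → (Lˣ →* ResidueField V) := fun σ =>
    { toFun := fun u => residue V ⟨_, hqV σ u⟩
      map_one' := by
        rw [← (residue V).map_one]
        congr 1
        apply Subtype.ext
        change ((σ ((1 : Lˣ) : L) : L) : Ω) / (((1 : Lˣ) : L) : Ω) = 1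
        rw [Units.val_one, map_one]
        push_cast
        exact div_one 1
      map_mul' := by
        intro u w
        rw [← map_mul]
        congr 1
        apply Subtype.ext
        change ((σ ((u * w : Lˣ) : L) : L) : Ω) / (((u * w : Lˣ) : L) : Ω) =
          ((σ (u : L) : L) : Ω) / ((u : L) : Ω) * (((σ (w : L) : L) : Ω) / ((w : L) : Ω))
        have hu0 : ((u : L) : Ω) ≠ 0 := by exact_mod_cast u.ne_zero
        have hw0 : ((w : L) : Ω) ≠ 0 := by exact_mod_cast w.ne_zero
        rw [Units.val_mul, map_mul]
        push_cast
        field_simp }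
  have hχ : ∀ (σ : L ≃ₐ[F] L) (u : Lˣ), χ σ u = residue V ⟨_, hqV σ u⟩ := fun σ u => rfl
  -- they are pairwise distinct
  have hinj : Function.Injective χ := by
    intro σ τ hστ
    by_contra hne
    obtain ⟨x, hx, hvx⟩ := exists_valuation_apply_sub_apply_eq V L hV hram hne
    let u : Lˣ := Units.mk0 x hx
    have hux : ((u : L) : Ω) = x := rfl
    have hx0 : (x : Ω) ≠ 0 := by exact_mod_cast hx
    have h1 : χ σ u = χ τ u := by rw [hστ]
    rw [hχ, hχ, ← sub_eq_zero, ← map_sub, residue_eq_zero_iff, V.valuation_lt_one_iff] at h1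
    change V.valuation (((σ (u : L) : L) : Ω) / ((u : L) : Ω) - ((τ (u : L) : L) : Ω) / ((u : L) : Ω)) < 1 at h1
    rw [hux, ← sub_div, map_div₀, div_lt_one₀ (zero_lt_iff.mpr ((Valuation.ne_zero_iff _).mpr hx0))] at h1
    change V.valuation (((σ x : L) : Ω) - τ x) < V.valuation (x : Ω) at h1
    rw [hvx] at h1
    exact lt_irrefl _ h1
  -- Artin: the characters are linearly independent over `Ωv`
  have hli : LinearIndependent (ResidueField V) (fun σ => (χ σ : Lˣ → ResidueField V)) :=
    (linearIndependent_monoidHom Lˣ (ResidueField V)).comp χ hinj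
  -- hence the combination with coefficients `(e σ)v` (not all zero: `(e σ₀)v = 1`) is non-zero
  set g : (L ≃ₐ[F] L) → ResidueField V := fun σ => residue V ⟨e σ, heV σ⟩ with hg
  have hg₀ : g σ₀ ≠ 0 := by
    rw [hg]
    dsimp only
    rw [hres_ne (heV σ₀), he₀, map_one]
  obtain ⟨u, hu⟩ : ∃ u : Lˣ, ∑ σ, g σ * χ σ u ≠ 0 := by
    by_contra hall
    push Not at hall
    have hsum : ∑ σ, g σ • (χ σ : Lˣ → ResidueField V) = 0 := by
      funext u
      rw [Finset.sum_apply, Pi.zero_apply]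
      simp only [Pi.smul_apply, smul_eq_mul]
      exact hall u
    exact hg₀ (Fintype.linearIndependent_iff.mp hli g hsum σ₀)
  -- the element `w = ∑ e σ · (σ u / u) ∈ V` has non-zero residue, hence value `1`
  let w : V := ∑ σ, (⟨e σ, heV σ⟩ : V) * ⟨_, hqV σ u⟩
  have hwres : residue V w = ∑ σ, g σ * χ σ u := by
    rw [map_sum]
    refine Finset.sum_congr rfl fun σ _ => ?_
    rw [map_mul, hχ]
  have hwval : V.valuation (w : Ω) = 1 := by
    have h1 : residue V ⟨(w : Ω), w.2⟩ ≠ 0 := by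
      rw [show (⟨(w : Ω), w.2⟩ : V) = w from rfl, hwres]
      exact hu
    exact (hres_ne w.2).mp h1
  have hwcoe : (w : Ω) = ∑ σ, e σ * (((σ (u : L) : L) : Ω) / ((u : L) : Ω)) := by
    simp only [w, AddSubmonoidClass.coe_finsetSum, MulMemClass.coe_mul]
  -- unwind: `∑ c σ · σ u = c σ₀ · u · w`
  have hu0 : ((u : L) : Ω) ≠ 0 := by exact_mod_cast u.ne_zero
  refine ⟨(u : L), u.ne_zero, ?_⟩
  have hid : ∑ σ, c σ * ((σ (u : L) : L) : Ω) = c σ₀ * ((u : L) : Ω) * (w : Ω) := by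
    rw [hwcoe, Finset.mul_sum]
    refine Finset.sum_congr rfl fun σ _ => ?_
    rw [he]
    dsimp only
    field_simp
  rw [hid, map_mul, map_mul, hwval, mul_one]

/-- **Kuhlmann–Vlahu 2014, §13: valuation independence of a Galois group with trivial
ramification group** ((13.1): "`v ∑ σᵢ(d) dᵢ = minᵢ v σᵢ(d) dᵢ`"; Thm. 13.2). Let every
automorphism of the finite extension `L|F` inside `(Ω, V)` preserve `v` (e.g. `F` henselian), and
let `G^r(L|F) = 1`. Then for coefficients `c : Gal(L|F) → Ω`, not all zero, there is `d ∈ L`,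
`d ≠ 0`, such that `|c_σ σ(d)| ≤ |∑_τ c_τ τ(d)|` for every `σ`, and the sum is non-zero.
[cite: KuhlmannVlahu2014, Section 13, (13.1) and Thm. 13.2] -/
theorem exists_valuation_mul_apply_le_sum [FiniteDimensional F L]
    (hV : ∀ (σ : L ≃ₐ[F] L) (x : L), V.valuation ((σ x : L) : Ω) = V.valuation (x : Ω))
    (hram : ramificationGroupIn V L = ⊥) (c : (L ≃ₐ[F] L) → Ω) (hc : ∃ σ, c σ ≠ 0) :
    ∃ d : L, d ≠ 0 ∧ (∑ τ, c τ * ((τ d : L) : Ω)) ≠ 0 ∧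
      ∀ σ, V.valuation (c σ * ((σ d : L) : Ω)) ≤ V.valuation (∑ τ, c τ * ((τ d : L) : Ω)) := by
  classical
  obtain ⟨σ₁, hσ₁⟩ := hc
  obtain ⟨σ₀, -, hmax⟩ := Finset.exists_max_image Finset.univ (fun σ => V.valuation (c σ))
    ⟨σ₁, Finset.mem_univ _⟩
  have hmax' : ∀ σ, V.valuation (c σ) ≤ V.valuation (c σ₀) := fun σ => hmax σ (Finset.mem_univ _)
  have hσ₀ : c σ₀ ≠ 0 := by
    intro h0
    have h1 := hmax' σ₁
    rw [h0, Valuation.map_zero, le_zero_iff, Valuation.zero_iff] at h1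
    exact hσ₁ h1
  obtain ⟨d, hd, hsum⟩ := exists_valuation_sum_mul_apply_eq V L hV hram c hσ₀ hmax'
  have hd0 : (d : Ω) ≠ 0 := by exact_mod_cast hd
  refine ⟨d, hd, ?_, fun σ => ?_⟩
  · rw [← Valuation.ne_zero_iff V.valuation, hsum]
    exact mul_ne_zero ((Valuation.ne_zero_iff _).mpr hσ₀) ((Valuation.ne_zero_iff _).mpr hd0)
  · rw [hsum, map_mul, hV]
    exact mul_le_mul' (hmax' σ) le_rfl

end Literature.AlgebraicGeometry.Resolution

end
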